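import Mathlib
import Literature.Computability.AlgebraicComplexity.NonscalarBorderRank
import Literature.Computability.AlgebraicComplexity.BideterminantReduction
import HarnessLib

/-!
# `O(ε^k)` bookkeeping for polynomials over `F((ε))`, the substitution `ε ↦ ε²`, and `F(ε)`

Topic `Literature/Computability/AlgebraicComplexity`. Seventh support file for the formalisation of
Andrews 2022, Theorem 3 (`DeterminantalIdealComplexity.lean`): the elementary calculus of error
terms used in the proof of Andrews' Proposition 2 (composition of the Andrews–Forbes reduction
with the trace-ABP gadget, the substitution "`ε ↦ ε²` and `δ ↦ ε`", and division by
`ε^{2q+1} α`), in the currency of `NonscalarBorderRank.IsOrdGE`.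

## Content

* `PolyOrdGE k p` — every `F((ε))`-coefficient of the polynomial `p` is `O(ε^k)`; closure under
  ring operations (`PolyOrdGE.mul`: orders add), substitution of `O(1)` polynomials
  (`PolyOrdGE.bind₁`), partial derivatives (`PolyOrdGE.pderiv`).
* `sqEps : F((ε)) →+* F((ε))`, `ε ↦ ε²` (Mathlib's `HahnSeries.embDomainRingHom` along `n ↦ 2n`),
  with `sqEps (single n a) = single (2n) a` and `IsOrdGE k x → IsOrdGE (2k) (sqEps x)`.
* The embedding `F(ε) = RatFunc F → F((ε))` (Mathlib's `algebraMap`): the tree's `IsBigOEps`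
  (`BideterminantReduction.lean`, Andrews–Forbes Def. 2.1) IS `IsOrdGE` of the image
  (`isBigOEps_iff_isOrdGE`), and the images of constants and of `ε^q`.

## References

* [Andrews2022] R. Andrews, FOCS 2022, arXiv:2208.01078, Def. 4, Lemma 3, Prop. 2 (proof).
* [AndrewsForbes2022] R. Andrews, M. A. Forbes, STOC 2022, arXiv:2112.00792, Def. 2.1.
-/

noncomputable section

open MvPolynomial
open scoped RatFunc

namespace Literature.Computability.AlgebraicComplexity

universe u v w

variable {F : Type u} [Field F]

/-- The structure map `F → F((ε))` is `HahnSeries.C`. [folklore] -/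
theorem algebraMap_laurentSeries_apply (a : F) :
    algebraMap F (LaurentSeries F) a = HahnSeries.C a := by
  rw [HahnSeries.algebraMap_apply', PowerSeries.algebraMap_apply, Algebra.algebraMap_self,
    RingHom.id_apply, HahnSeries.ofPowerSeries_C]

/-! ### Polynomials with `O(ε^k)` coefficients -/

/-- `PolyOrdGE k p`: every coefficient of `p ∈ F((ε))[X_σ]` is `O(ε^k)` (Andrews' "`ε^k · g` with
`g ∈ F[ε][X]`", coefficientwise and inside `F((ε))`). [cite: Andrews2022, Def. 4] -/
def PolyOrdGE {σ : Type v} (k : ℤ) (p : MvPolynomial σ (LaurentSeries F)) : Prop :=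
  ∀ e, IsOrdGE k (coeff e p)

namespace PolyOrdGE

variable {σ : Type v} {τ : Type w}

/-- `0`. [folklore] -/
theorem zero (k : ℤ) : PolyOrdGE k (0 : MvPolynomial σ (LaurentSeries F)) := fun e => by
  rw [coeff_zero]
  exact IsOrdGE.zero k

/-- Weakening. [folklore] -/
theorem mono {k l : ℤ} (h : l ≤ k) {p : MvPolynomial σ (LaurentSeries F)} (hp : PolyOrdGE k p) :
    PolyOrdGE l p := fun e => (hp e).mono h

/-- Sums. [folklore] -/
theorem add {k : ℤ} {p q : MvPolynomial σ (LaurentSeries F)} (hp : PolyOrdGE k p)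
    (hq : PolyOrdGE k q) : PolyOrdGE k (p + q) := fun e => by
  rw [coeff_add]
  exact (hp e).add (hq e)

/-- Negation. [folklore] -/
theorem neg {k : ℤ} {p : MvPolynomial σ (LaurentSeries F)} (hp : PolyOrdGE k p) :
    PolyOrdGE k (-p) := fun e => by
  rw [coeff_neg]
  exact (hp e).neg

/-- Differences. [folklore] -/
theorem sub {k : ℤ} {p q : MvPolynomial σ (LaurentSeries F)} (hp : PolyOrdGE k p)
    (hq : PolyOrdGE k q) : PolyOrdGE k (p - q) := fun e => by
  rw [coeff_sub]
  exact (hp e).sub (hq e)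

/-- Finite sums. [folklore] -/
theorem sum {k : ℤ} {ι : Type w} {s : Finset ι} {f : ι → MvPolynomial σ (LaurentSeries F)}
    (h : ∀ i ∈ s, PolyOrdGE k (f i)) : PolyOrdGE k (∑ i ∈ s, f i) := fun e => by
  rw [coeff_sum]
  exact IsOrdGE.sum fun i hi => h i hi e

/-- Constants. [folklore] -/
theorem C {k : ℤ} {a : LaurentSeries F} (ha : IsOrdGE k a) :
    PolyOrdGE k (C a : MvPolynomial σ (LaurentSeries F)) := fun e => by
  classical
  rw [coeff_C]
  split_ifs
  · exact ha
  · exact IsOrdGE.zero k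

/-- Monomials. [folklore] -/
theorem monomial {k : ℤ} (d : σ →₀ ℕ) {a : LaurentSeries F} (ha : IsOrdGE k a) :
    PolyOrdGE k (monomial d a) := fun e => by
  classical
  rw [coeff_monomial]
  split_ifs
  · exact ha
  · exact IsOrdGE.zero k

/-- `1 = O(1)`. [folklore] -/
theorem one : PolyOrdGE 0 (1 : MvPolynomial σ (LaurentSeries F)) := fun e => by
  classical
  rw [coeff_one]
  split_ifs
  · exact IsOrdGE.one
  · exact IsOrdGE.zero 0

/-- Variables are `O(1)`. [folklore] -/
theorem X (i : σ) : PolyOrdGE 0 (MvPolynomial.X i : MvPolynomial σ (LaurentSeries F)) :=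
  monomial (Finsupp.single i 1) IsOrdGE.one

/-- **Products**: `O(ε^k) · O(ε^l) = O(ε^{k+l})` coefficientwise. [folklore] -/
theorem mul {k l : ℤ} {p q : MvPolynomial σ (LaurentSeries F)} (hp : PolyOrdGE k p)
    (hq : PolyOrdGE l q) : PolyOrdGE (k + l) (p * q) := fun e => by
  classical
  rw [coeff_mul]
  exact IsOrdGE.sum fun x _ => (hp x.1).mul (hq x.2)

/-- Powers of `O(1)` polynomials. [folklore] -/
theorem pow {p : MvPolynomial σ (LaurentSeries F)} (hp : PolyOrdGE 0 p) (n : ℕ) :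
    PolyOrdGE 0 (p ^ n) := by
  induction n with
  | zero => simpa using one
  | succ n ih =>
    rw [pow_succ]
    simpa using ih.mul hp

/-- Finite products of `O(1)` polynomials. [folklore] -/
theorem prod {ι : Type w} {s : Finset ι} {f : ι → MvPolynomial σ (LaurentSeries F)}
    (h : ∀ i ∈ s, PolyOrdGE 0 (f i)) : PolyOrdGE 0 (∏ i ∈ s, f i) := by
  classical
  induction s using Finset.induction_on with
  | empty => simpa using one
  | insert a s ha ih =>
    rw [Finset.prod_insert ha]
    simpa using (h a (Finset.mem_insert_self a s)).mul
      (ih fun i hi => h i (Finset.mem_insert_of_mem hi))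

/-- **Substitution of `O(1)` polynomials** keeps `O(ε^k)` coefficients. [folklore] -/
theorem bind₁ {k : ℤ} {p : MvPolynomial σ (LaurentSeries F)} (hp : PolyOrdGE k p)
    {θ : σ → MvPolynomial τ (LaurentSeries F)} (hθ : ∀ i, PolyOrdGE 0 (θ i)) :
    PolyOrdGE k (MvPolynomial.bind₁ θ p) := by
  rw [p.as_sum, map_sum]
  refine sum fun d _ => ?_
  rw [bind₁_monomial]
  simpa using (C (hp d)).mul (prod fun i _ => (hθ i).pow (d i))

/-- Extension of scalars from `F`: polynomials over `F` are `O(1)`. [folklore] -/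
theorem map_algebraMap (p : MvPolynomial σ F) :
    PolyOrdGE 0 (MvPolynomial.map (algebraMap F (LaurentSeries F)) p) := fun e => by
  rw [coeff_map, algebraMap_laurentSeries_apply]
  exact IsOrdGE.C _

/-- **Partial derivatives** keep `O(ε^k)` coefficients. [folklore] -/
theorem pderiv {k : ℤ} {p : MvPolynomial σ (LaurentSeries F)} (hp : PolyOrdGE k p) (i : σ) :
    PolyOrdGE k (MvPolynomial.pderiv i p) := by
  rw [p.as_sum, map_sum]
  refine sum fun d _ => ?_
  rw [pderiv_monomial]
  refine monomial _ ?_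
  rw [← nsmul_eq_mul']
  -- `n • a = O(ε^k)`
  intro j hj
  rw [HahnSeries.coeff_nsmul, Pi.smul_apply, hp d j hj, smul_zero]

end PolyOrdGE

/-! ### The substitution `ε ↦ ε²` -/

/-- Doubling `ℤ →+ ℤ`. [folklore] -/
def doubleHom : ℤ →+ ℤ where
  toFun n := 2 * n
  map_zero' := by simp
  map_add' a b := by ring

/-- **`ε ↦ ε²`** on `F((ε))`: the ring endomorphism reindexing a Laurent series along `n ↦ 2n`
(Andrews 2022, proof of Prop. 2: "Performing the substitution `ε ↦ ε²`"). [cite: Andrews2022, Prop. 2 (proof)] -/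
def sqEps : LaurentSeries F →+* LaurentSeries F :=
  HahnSeries.embDomainRingHom doubleHom
    (fun a b h => by simpa [doubleHom] using h)
    (fun a b => by simp [doubleHom])

/-- `sqEps` fixes constants. [folklore] -/
@[simp] theorem sqEps_C (a : F) : sqEps (HahnSeries.C a) = HahnSeries.C a :=
  HahnSeries.embDomainRingHom_C

/-- `sqEps (a ε^n) = a ε^{2n}`. [folklore] -/
@[simp] theorem sqEps_single (n : ℤ) (a : F) :
    sqEps (HahnSeries.single n a) = HahnSeries.single (2 * n) a := by
  rw [sqEps, HahnSeries.embDomainRingHom_apply, HahnSeries.embDomain_single]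
  rfl

/-- Even coefficients of `sqEps x`. [folklore] -/
theorem coeff_sqEps_two_mul (x : LaurentSeries F) (i : ℤ) : (sqEps x).coeff (2 * i) = x.coeff i := by
  rw [sqEps, HahnSeries.embDomainRingHom_apply]
  exact HahnSeries.embDomain_coeff (a := i)

/-- Odd coefficients of `sqEps x` vanish. [folklore] -/
theorem coeff_sqEps_eq_zero (x : LaurentSeries F) {j : ℤ} (hj : ∀ i, j ≠ 2 * i) :
    (sqEps x).coeff j = 0 := by
  rw [sqEps, HahnSeries.embDomainRingHom_apply]
  refine HahnSeries.embDomain_notin_range ?_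
  rintro ⟨i, rfl⟩
  exact hj i rfl

/-- `sqEps` doubles orders: `O(ε^k) ↦ O(ε^{2k})`. [folklore] -/
theorem IsOrdGE.sqEps {k : ℤ} {x : LaurentSeries F} (hx : IsOrdGE k x) : IsOrdGE (2 * k) (sqEps x) := by
  intro j hj
  by_cases h : ∃ i, j = 2 * i
  · obtain ⟨i, rfl⟩ := h
    rw [coeff_sqEps_two_mul]
    exact hx i (by omega)
  · push Not at h
    exact coeff_sqEps_eq_zero x h

/-- `sqEps` coefficientwise on polynomials doubles orders. [folklore] -/
theorem PolyOrdGE.map_sqEps {σ : Type v} {k : ℤ} {p : MvPolynomial σ (LaurentSeries F)}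
    (hp : PolyOrdGE k p) : PolyOrdGE (2 * k) (MvPolynomial.map sqEps p) := fun e => by
  rw [coeff_map]
  exact (hp e).sqEps

/-- `sqEps` is compatible with the `F`-algebra structure. [folklore] -/
theorem sqEps_comp_algebraMap :
    (sqEps : LaurentSeries F →+* LaurentSeries F).comp (algebraMap F (LaurentSeries F)) =
      algebraMap F (LaurentSeries F) := by
  refine RingHom.ext fun a => ?_
  rw [RingHom.comp_apply, algebraMap_laurentSeries_apply, sqEps_C]

/-! ### `F(ε) ⊆ F((ε))` -/

/-- The tree's `IsBigOEps F k g` (Andrews–Forbes Def. 2.1: `g ∈ F(ε)` is `O(ε^k)`) is literally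
`IsOrdGE k` of the image of `g` in `F((ε))`. [cite: AndrewsForbes2022, Def. 2.1] -/
theorem isBigOEps_iff_isOrdGE (k : ℤ) (g : RatFunc F) :
    IsBigOEps F k g ↔ IsOrdGE k (g : LaurentSeries F) :=
  Iff.rfl

/-- Constants of `F(ε)` are constants of `F((ε))`. [folklore] -/
theorem coe_ratFunc_algebraMap (a : F) :
    ((algebraMap F (RatFunc F) a : RatFunc F) : LaurentSeries F) = HahnSeries.C a := by
  rw [RatFunc.algebraMap_eq_C, ← RatFunc.algebraMap_C, ← IsScalarTower.algebraMap_apply,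
    Polynomial.algebraMap_hahnSeries_apply, Polynomial.coe_C, HahnSeries.ofPowerSeries_C]

/-- The composite `F → F(ε) → F((ε))` is the structure map of `F((ε))`. [folklore] -/
theorem algebraMap_ratFunc_comp_algebraMap :
    (algebraMap (RatFunc F) (LaurentSeries F)).comp (algebraMap F (RatFunc F)) =
      algebraMap F (LaurentSeries F) := by
  refine RingHom.ext fun a => ?_
  rw [RingHom.comp_apply, algebraMap_laurentSeries_apply]
  exact coe_ratFunc_algebraMap a

/-- `ε^q ∈ F(ε)` maps to `single q 1`. [folklore] -/
theorem coe_ratFunc_X_zpow (q : ℤ) :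
    ((RatFunc.X ^ q : RatFunc F) : LaurentSeries F) = HahnSeries.single q 1 := by
  rw [map_zpow₀, RatFunc.coe_X, ← RatFunc.single_zpow]

end Literature.Computability.AlgebraicComplexity
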